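import Literature.MathematicalPhysics.QuantumFieldTheory.Balaban1983to89.TreeLength

/-!
# NE9TreeBlockChain — a connected polygonal graph of sup-length `< n` meets unit cubes only inside a KING-CONNECTED CHAIN of at most
# `4n − 1` blocks of `2^d` cubes (cell `pub-balaban`, T4-DAG §2 node U3 / §6 rows NE9 ∕ NE5; NE9 formalisation swarm LEAF PROVER 05, lineage
# leaf-05, generation 4; part A of the lineage item «(1.26) direct on the torus model by a block-chain discretisation» — part B
# `NE9TorusIneq126Chain` counts with it)

HONEST FRAMING (T4-DAG PAGE 1).  Rung (B)+1 of the FINITE-VOLUME T⁴ programme — existence AND uniqueness of the ε → 0 limit of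
gauge-invariant observables on a fixed torus; NOT infinite volume, NOT a mass gap, NOT the Clay problem.  NE9 (`T4OutputRate.NE9` ∧
`FadingMemory`) is a cell NEW ESTIMATE, NOT PRINTED, and is NOT discharged here («NE9 ⇐ the named binders»); spine 0/9 unchanged; 0/18
leaves instantiated on Bałaban's objects.  HONEST DEPENDENCY (cell line, verbatim): continuum YM on T⁴ ⇐ BetaPertH ∧ nine spine estimates
(0/9 proved); BetaPertH ⇐ (D1) ∧ (D4) ∧ CAP+tail; G-an2-4 gates asym, D1 and NE2/3/4.  `FlowStep.BetaPertH`, (B), (B^μ) do not occur here.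
Nothing printed in the audited series is asserted (ABSOLUTE RULE); [Balaban1987RG1] p. 257 is quoted for the TYPE of the objects only.

WHY (located point = FINDING F-ne9leaf05g3-1, GAPS.md).  Every TR-currency producer of the cell evaluates [II] (1.26) through unit pv03's
VOLUME-LEAF route (`B12TreeDecay.ineq126_of_volumeLeaf`: `e^{−κd} ≤ e^{κ}·e^{−(κ/c₀)|X|}` and the lazy-walk animal count, `c₀ = 4·2^d`,
`Δ = 2d`), whence the threshold `κ₀ = 64·log 162 ≈ 325.6` and the constant `K₀ = 162⁶⁴/81 ∈ (10¹³⁹, 10¹⁴⁰)` for `d = 4`.  A DIRECT count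
needs a discretisation of the admissible graph itself.  THIS FILE supplies it, in the universal cover `ℝ^d` with the conventions of unit
pv22 (`TreeLength`: sup metric, polygonal graphs `carrier T`, `len T`, closed unit cubes `cube x`, `x ∈ ℤ^d`):
* §1 a `2ρ`-SEPARATED finite set of points of a connected graph with at least two members has `|S|·ρ ≤ len T` (the capture lemma
  `TreeLength.le_lenIn_closedBall` and the additivity `TreeLength.sum_lenIn_le_len` BY NAME — the device inside pv22's
  `card_le_of_sAdmissible`, freed from the witness points), hence `|S| ≤ max(1, len T/ρ)`;
* §2 a MAXIMAL such set through a given point exists and is a `2ρ`-NET of the carrier;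
* §3 CHAIN LEMMA: if finitely many closed balls of radius `r` centred on a connected carrier cover it, the graph «centres at distance
  `≤ 2r`» is connected (`isPreconnected_iff_subset_of_disjoint_closed`);
* §4 BLOCK CHAIN (`0 < ρ < 1/4`): the corners `m(s)_μ := ⌈s_μ − 2ρ − 1⌉` of the net form a KING-connected family `A ⊂ ℤ^d`
  (`|m(s)_μ − m(s′)_μ| ≤ 1` along the edges of §3), `|A| ≤ |S|`, and every unit cube met by the graph lies in a block `m + {0,1}^d`, `m ∈ A`;
  MAIN THEOREM `exists_blockChain`: a connected graph of sup-length `< n` (`n ≥ 1`) meets cubes only inside a king-connected chain of at most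
  `4n − 1` blocks, one of which contains any prescribed met cube.
DISGUISE TEST: elementary metric geometry of polygonal graphs and unit cubes; no activity, no history, no torus — not NE9, not NE5.

References (TYPES only): T. Bałaban, *Renormalization group approach to lattice gauge field theories. I*, Commun. Math. Phys. **109**,
249–301 (1987) [Balaban1987RG1], p. 257 (cubes, graphs «in the continuous space», the linear size d_j); J. Dimock, *The renormalization
group according to Balaban. II. Large fields*, J. Math. Phys. **54** (2013) 092301 [Dimock2013BalabanII], App. E (sup-metric convention,
*"at most 2^d blocks be mutually touching"*).  Summits-side NEW work (LEAN PLACEMENT RULE); imports `…Balaban1983to89.TreeLength` only;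
modifies nothing; no `def`, no `def … : Prop`; 0 sorry.  Value = kernel geometry for the cell's census, NOT summit progress.
-/

noncomputable section

namespace Summit.QuantumFields.BalabanUV.T4Continuum.NE9TreeBlockChain

open Literature.MathematicalPhysics.QuantumFieldTheory.Balaban1983to89
open Literature.MathematicalPhysics.QuantumFieldTheory.Balaban1983to89.B13ScaleTransfer (Pt)
open Literature.MathematicalPhysics.QuantumFieldTheory.Balaban1983to89.TreeLength

variable {d : ℕ}

/-! ## §1 Separated subsets of a connected graph are small -/

/-- PACKING BY CAPTURE: a `2ρ`-separated finite set `S` of points of a connected polygonal graph `T` with `|S| ≥ 2` satisfies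
`|S|·ρ ≤ len T` — the closed balls `B̄(s, ρ)`, `s ∈ S`, are pairwise disjoint and each captures length `≥ ρ` of `T`
(`TreeLength.le_lenIn_closedBall`, `TreeLength.sum_lenIn_le_len` BY NAME). [folklore] -/
theorem card_mul_le_len_of_separated {T : List (Seg d)} (hT : IsPreconnected (carrier T)) {ρ : ℝ} (hρ : 0 < ρ)
    {S : Finset (RPt d)} (hST : ∀ s ∈ S, s ∈ carrier T) (hsep : ∀ a ∈ S, ∀ b ∈ S, a ≠ b → 2 * ρ < dist a b)
    (h2 : 1 < S.card) : (S.card : ℝ) * ρ ≤ len T := by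
  have hcap : ∀ y ∈ S, ρ ≤ lenIn (Metric.closedBall y ρ) T := by
    intro y hy
    obtain ⟨y', hy', hne⟩ := (Finset.one_lt_card_iff_nontrivial.1 h2).exists_ne y
    have hfar : ρ ≤ dist y y' := by
      have := hsep y hy y' hy' hne.symm
      linarith
    exact le_lenIn_closedBall hT (hST y hy) (hST y' hy') hρ hfar
  have hdisj : (S : Set (RPt d)).PairwiseDisjoint (fun y => Metric.closedBall y ρ) := by
    intro a ha b hb hab
    exact Metric.closedBall_disjoint_closedBall (by have := hsep a ha b hb hab; linarith)
  calc (S.card : ℝ) * ρ = ∑ _y ∈ S, ρ := by rw [Finset.sum_const, nsmul_eq_mul]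
    _ ≤ ∑ y ∈ S, lenIn (Metric.closedBall y ρ) T := Finset.sum_le_sum hcap
    _ ≤ len T := sum_lenIn_le_len S _ (fun y _ => Metric.isClosed_closedBall) hdisj T

/-- Hence a `2ρ`-separated finite set of points of a connected graph has `|S| ≤ max(1, len T/ρ)`. [folklore] -/
theorem card_le_max_of_separated {T : List (Seg d)} (hT : IsPreconnected (carrier T)) {ρ : ℝ} (hρ : 0 < ρ)
    {S : Finset (RPt d)} (hST : ∀ s ∈ S, s ∈ carrier T) (hsep : ∀ a ∈ S, ∀ b ∈ S, a ≠ b → 2 * ρ < dist a b) :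
    (S.card : ℝ) ≤ max 1 (len T / ρ) := by
  rcases Nat.lt_or_ge 1 S.card with h1 | h1
  · calc (S.card : ℝ) ≤ len T / ρ := by
          rw [le_div_iff₀ hρ]
          exact card_mul_le_len_of_separated hT hρ hST hsep h1
      _ ≤ max 1 (len T / ρ) := le_max_right _ _
  · calc (S.card : ℝ) ≤ 1 := by exact_mod_cast h1
      _ ≤ max 1 (len T / ρ) := le_max_left _ _

/-! ## §2 A maximal separated set through a point is a net -/

/-- **NET LEMMA**: through any point `p₀` of a connected polygonal graph `T` there is a finite `2ρ`-separated set `S ∋ p₀` of points of `T`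
which is a `2ρ`-NET of the carrier (every point of `T` is within `2ρ` of `S`) and has `|S| ≤ max(1, len T/ρ)` — a separated set of
maximal cardinality (which is bounded by §1). [folklore] -/
theorem exists_net {T : List (Seg d)} (hT : IsPreconnected (carrier T)) {ρ : ℝ} (hρ : 0 < ρ) {p₀ : RPt d}
    (hp₀ : p₀ ∈ carrier T) :
    ∃ S : Finset (RPt d), p₀ ∈ S ∧ (∀ s ∈ S, s ∈ carrier T) ∧ (∀ a ∈ S, ∀ b ∈ S, a ≠ b → 2 * ρ < dist a b) ∧
      (∀ q ∈ carrier T, ∃ s ∈ S, dist q s ≤ 2 * ρ) ∧ (S.card : ℝ) ≤ max 1 (len T / ρ) := by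
  classical
  -- the admissible separated sets through `p₀`, indexed by cardinality
  let P : ℕ → Prop := fun k => ∃ S : Finset (RPt d), p₀ ∈ S ∧ (∀ s ∈ S, s ∈ carrier T) ∧
      (∀ a ∈ S, ∀ b ∈ S, a ≠ b → 2 * ρ < dist a b) ∧ S.card = k
  let B : ℕ := ⌈len T / ρ⌉₊ + 1
  have hbound : ∀ S : Finset (RPt d), (∀ s ∈ S, s ∈ carrier T) →
      (∀ a ∈ S, ∀ b ∈ S, a ≠ b → 2 * ρ < dist a b) → S.card ≤ B := by
    intro S hST hsep
    have h1 := card_le_max_of_separated hT hρ hST hsep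
    have h2 : max 1 (len T / ρ) ≤ (⌈len T / ρ⌉₊ : ℝ) + 1 :=
      max_le (by have := Nat.cast_nonneg (α := ℝ) ⌈len T / ρ⌉₊; linarith)
        ((Nat.le_ceil _).trans (le_add_of_nonneg_right zero_le_one))
    have h3 : (S.card : ℝ) ≤ ((⌈len T / ρ⌉₊ + 1 : ℕ) : ℝ) := by
      rw [Nat.cast_add, Nat.cast_one]
      exact h1.trans h2
    exact_mod_cast h3
  have hP1 : P 1 := ⟨{p₀}, Finset.mem_singleton_self _, fun s hs => by rwa [Finset.mem_singleton.1 hs],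
    fun a ha b hb hab => absurd ((Finset.mem_singleton.1 ha).trans (Finset.mem_singleton.1 hb).symm) hab,
    Finset.card_singleton _⟩
  have h1B : 1 ≤ B := Nat.le_add_left 1 _
  obtain ⟨S, hp₀S, hST, hsep, hcard⟩ : P (Nat.findGreatest P B) := Nat.findGreatest_spec h1B hP1
  refine ⟨S, hp₀S, hST, hsep, ?_, card_le_max_of_separated hT hρ hST hsep⟩
  intro q hq
  by_contra hfar
  push Not at hfar
  have hqS : q ∉ S := by
    intro h
    have := hfar q h
    rw [dist_self] at this
    linarith
  have hP' : P (Nat.findGreatest P B + 1) := by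
    refine ⟨insert q S, Finset.mem_insert_of_mem hp₀S, ?_, ?_, ?_⟩
    · intro s hs
      rcases Finset.mem_insert.1 hs with rfl | hs
      · exact hq
      · exact hST s hs
    · intro a ha b hb hab
      rw [Finset.mem_insert] at ha hb
      rcases ha with rfl | ha
      · rcases hb with rfl | hb
        · exact absurd rfl hab
        · exact hfar b hb
      · rcases hb with rfl | hb
        · rw [dist_comm]; exact hfar a ha
        · exact hsep a ha b hb hab
    · rw [Finset.card_insert_of_notMem hqS, hcard]
  have hle : Nat.findGreatest P B + 1 ≤ B := by
    obtain ⟨S', -, hST', hsep', hcard'⟩ := hP'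
    exact hcard' ▸ hbound S' hST' hsep'
  have := Nat.le_findGreatest hle hP'
  omega

/-! ## §3 Chain lemma: a finite closed-ball cover of a connected carrier has a connected overlap graph -/

/-- **CHAIN LEMMA**: let `S` be a finite set of points of a connected polygonal graph `T` such that every point of `T` is within `r` of
`S`.  Then any two members of `S` are joined by a chain of members of `S` with consecutive distances `≤ 2r` (the two unions of balls
over a would-be component and its complement are closed, cover the carrier and are disjoint on it). [folklore] -/
theorem net_chain {T : List (Seg d)} (hT : IsPreconnected (carrier T)) {r : ℝ} {S : Finset (RPt d)}
    (hST : ∀ s ∈ S, s ∈ carrier T) (hcov : ∀ q ∈ carrier T, ∃ s ∈ S, dist q s ≤ r) {s₀ : RPt d} (hs₀ : s₀ ∈ S)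
    {s : RPt d} (hs : s ∈ S) :
    Relation.ReflTransGen (fun a b => dist a b ≤ 2 * r ∧ a ∈ S ∧ b ∈ S) s₀ s := by
  classical
  set C : Finset (RPt d) := S.filter fun c => Relation.ReflTransGen (fun a b => dist a b ≤ 2 * r ∧ a ∈ S ∧ b ∈ S) s₀ c
    with hC
  set U₁ : Set (RPt d) := ⋃ c ∈ C, Metric.closedBall c r with hU₁
  set U₂ : Set (RPt d) := ⋃ c ∈ S \ C, Metric.closedBall c r with hU₂
  have hU₁c : IsClosed U₁ := isClosed_biUnion_finset fun c _ => Metric.isClosed_closedBall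
  have hU₂c : IsClosed U₂ := isClosed_biUnion_finset fun c _ => Metric.isClosed_closedBall
  have hstep : ∀ c ∈ C, ∀ c' ∈ S, dist c c' ≤ 2 * r → c' ∈ C := by
    intro c hc c' hc' hd
    rw [hC, Finset.mem_filter] at hc ⊢
    exact ⟨hc', hc.2.tail ⟨hd, hc.1, hc'⟩⟩
  have hcovU : carrier T ⊆ U₁ ∪ U₂ := by
    intro q hq
    obtain ⟨c, hc, hqc⟩ := hcov q hq
    by_cases hcC : c ∈ C
    · exact Or.inl (Set.mem_iUnion₂.2 ⟨c, hcC, Metric.mem_closedBall.2 hqc⟩)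
    · exact Or.inr (Set.mem_iUnion₂.2 ⟨c, Finset.mem_sdiff.2 ⟨hc, hcC⟩, Metric.mem_closedBall.2 hqc⟩)
  have hdisj : carrier T ∩ (U₁ ∩ U₂) = ∅ := by
    ext q
    simp only [Set.mem_inter_iff, Set.mem_empty_iff_false, iff_false, not_and]
    intro _ h1 h2
    obtain ⟨c, hc, hqc⟩ := Set.mem_iUnion₂.1 h1
    obtain ⟨c', hc', hqc'⟩ := Set.mem_iUnion₂.1 h2
    rw [Metric.mem_closedBall] at hqc hqc'
    have hd : dist c c' ≤ 2 * r :=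
      calc dist c c' ≤ dist c q + dist q c' := dist_triangle _ _ _
        _ = dist q c + dist q c' := by rw [dist_comm c q]
        _ ≤ r + r := add_le_add hqc hqc'
        _ = 2 * r := by ring
    exact (Finset.mem_sdiff.1 hc').2 (hstep c hc c' (Finset.mem_sdiff.1 hc').1 hd)
  have hs₀C : s₀ ∈ C := by
    rw [hC, Finset.mem_filter]
    exact ⟨hs₀, Relation.ReflTransGen.refl⟩
  rcases (isPreconnected_iff_subset_of_disjoint_closed.1 hT) U₁ U₂ hU₁c hU₂c hcovU hdisj with h | h
  · obtain ⟨c, hc, hsc⟩ := Set.mem_iUnion₂.1 (h (hST s hs))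
    rw [Metric.mem_closedBall] at hsc
    have hr : 0 ≤ r := dist_nonneg.trans hsc
    have hsC : s ∈ C := hstep c hc s hs (by rw [dist_comm]; linarith)
    rw [hC, Finset.mem_filter] at hsC
    exact hsC.2
  · obtain ⟨c', hc', hsc'⟩ := Set.mem_iUnion₂.1 (h (hST s₀ hs₀))
    rw [Metric.mem_closedBall] at hsc'
    have hr : 0 ≤ r := dist_nonneg.trans hsc'
    have hc'C : c' ∈ C := hstep s₀ hs₀C c' (Finset.mem_sdiff.1 hc').1 (by linarith)
    exact absurd hc'C (Finset.mem_sdiff.1 hc').2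

/-! ## §4 The block chain -/

/-- THE BLOCK OF A NEARBY CUBE ([Dimock2013BalabanII] App. E, proof of Lemma E.1 (3): *"at most 2^d blocks be mutually touching"* — the
device of pv22's `card_le_of_sAdmissible`): if a point `w` of the unit cube of index `x` is within `2ρ` of `s` and `ρ < 1/4`, then
`x_μ ∈ {m_μ, m_μ + 1}` with `m_μ = ⌈s_μ − 2ρ − 1⌉`, for every coordinate `μ`. [folklore] -/
theorem mem_block_of_near {ρ : ℝ} (hρ4 : ρ < 1 / 4) {x : Pt d} {w s : RPt d} (hw : w ∈ cube x)
    (hws : dist w s ≤ 2 * ρ) (μ : Fin d) :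
    x μ = ⌈s μ - 2 * ρ - 1⌉ ∨ x μ = ⌈s μ - 2 * ρ - 1⌉ + 1 := by
  have hc := (mem_cube.1 hw) μ
  have hdμ : dist (w μ) (s μ) ≤ 2 * ρ := (dist_le_pi_dist _ _ μ).trans hws
  rw [Real.dist_eq, abs_le] at hdμ
  have h1 : s μ - 2 * ρ - 1 ≤ (x μ : ℝ) := by linarith [hc.1, hc.2, hdμ.1, hdμ.2]
  have h2 : ((x μ : ℤ) : ℝ) < (⌈s μ - 2 * ρ - 1⌉ : ℝ) + 2 := by
    have := Int.le_ceil (s μ - 2 * ρ - 1)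
    linarith [hc.1, hdμ.2]
  have hm1 : ⌈s μ - 2 * ρ - 1⌉ ≤ x μ := Int.ceil_le.2 h1
  have hm2 : x μ < ⌈s μ - 2 * ρ - 1⌉ + 2 := by exact_mod_cast h2
  omega

/-- CORNERS OF CLOSE CENTRES ARE KING-ADJACENT: if `dist s s′ ≤ 4ρ` and `ρ < 1/4` then `⌈s_μ − 2ρ − 1⌉` and `⌈s′_μ − 2ρ − 1⌉` differ by at
most `1`, for every `μ`. [folklore] -/
theorem ceil_king_of_dist {ρ : ℝ} (hρ4 : ρ < 1 / 4) {s s' : RPt d} (h : dist s s' ≤ 4 * ρ) (μ : Fin d) :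
    ⌈s μ - 2 * ρ - 1⌉ - 1 ≤ ⌈s' μ - 2 * ρ - 1⌉ ∧ ⌈s' μ - 2 * ρ - 1⌉ ≤ ⌈s μ - 2 * ρ - 1⌉ + 1 := by
  have hdμ : dist (s μ) (s' μ) ≤ 4 * ρ := (dist_le_pi_dist _ _ μ).trans h
  rw [Real.dist_eq, abs_le] at hdμ
  have hl := Int.le_ceil (s μ - 2 * ρ - 1)
  have hl' := Int.le_ceil (s' μ - 2 * ρ - 1)
  constructor
  · have : ⌈s μ - 2 * ρ - 1⌉ ≤ ⌈s' μ - 2 * ρ - 1⌉ + 1 := by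
      refine Int.ceil_le.2 ?_
      push_cast
      linarith
    omega
  · refine Int.ceil_le.2 ?_
    push_cast
    linarith

/-- **MAIN THEOREM — THE BLOCK CHAIN.**  Let `T` be a connected polygonal graph of `ℝ^d` of sup-length `len T < n` (`n ≥ 1` an integer)
meeting the unit cube of index `x₀`.  Then there is a finite family `A ⊂ ℤ^d` of CORNERS with a distinguished `a₀ ∈ A` such that:
`x₀` lies in the block `a₀ + {0,1}^d`; `|A| ≤ 4n − 1`; every `a ∈ A` is joined to `a₀` by a chain in `A` of KING steps (coordinates
change by at most `1`); and EVERY unit cube met by `T` lies in a block `a + {0,1}^d`, `a ∈ A`.  (§2 net at a radius `ρ ∈ (len T/(4n), 1/4)`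
through a point of `T` in the cube `x₀`, §3 chain, §4 corners.) [folklore] -/
theorem exists_blockChain {T : List (Seg d)} (hT : IsPreconnected (carrier T)) {n : ℕ} (hn : 1 ≤ n)
    (hlen : len T < n) {x₀ : Pt d} (hx₀ : (carrier T ∩ cube x₀).Nonempty) :
    ∃ A : Finset (Pt d), ∃ a₀ ∈ A, (∀ μ, x₀ μ = a₀ μ ∨ x₀ μ = a₀ μ + 1) ∧ A.card ≤ 4 * n - 1 ∧
      (∀ a ∈ A, Relation.ReflTransGen
        (fun a b : Pt d => (∀ μ, a μ - 1 ≤ b μ ∧ b μ ≤ a μ + 1) ∧ a ∈ A ∧ b ∈ A) a₀ a) ∧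
      ∀ x : Pt d, (carrier T ∩ cube x).Nonempty → ∃ a ∈ A, ∀ μ, x μ = a μ ∨ x μ = a μ + 1 := by
  classical
  obtain ⟨w₀, hw₀T, hw₀x⟩ := hx₀
  have hlen0 : 0 ≤ len T := len_nonneg T
  have hn' : (1 : ℝ) ≤ n := by exact_mod_cast hn
  -- the radius
  set ρ : ℝ := (len T / (4 * n) + 1 / 4) / 2 with hρdef
  have hρ : 0 < ρ := by rw [hρdef]; positivity
  have hq : len T / (4 * n) < 1 / 4 := by
    rw [div_lt_iff₀ (by positivity)]
    linarith
  have hρ4 : ρ < 1 / 4 := by rw [hρdef]; linarith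
  have hρℓ : len T / ρ < 4 * n := by
    rw [div_lt_iff₀ hρ, hρdef]
    have : len T / (4 * n) * (4 * n) = len T := div_mul_cancel₀ _ (by positivity)
    nlinarith
  -- the net
  obtain ⟨S, hw₀S, hST, hsep, hcov, hcard⟩ := exists_net hT hρ hw₀T
  -- the corners
  let m : RPt d → Pt d := fun s μ => ⌈s μ - 2 * ρ - 1⌉
  refine ⟨S.image m, m w₀, Finset.mem_image_of_mem m hw₀S, ?_, ?_, ?_, ?_⟩
  · intro μ
    exact mem_block_of_near hρ4 hw₀x (by rw [dist_self]; positivity) μ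
  · have h1 : ((S.image m).card : ℝ) < 4 * n := by
      calc ((S.image m).card : ℝ) ≤ S.card := by exact_mod_cast Finset.card_image_le
        _ ≤ max 1 (len T / ρ) := hcard
        _ < 4 * n := max_lt (by linarith) hρℓ
    have h2 : (S.image m).card < 4 * n := by exact_mod_cast h1
    omega
  · -- king connectivity along the chain of §3 (radius `2ρ`, steps of length `≤ 4ρ < 1`)
    have hlift : ∀ s, Relation.ReflTransGen (fun a b => dist a b ≤ 2 * (2 * ρ) ∧ a ∈ S ∧ b ∈ S) w₀ s →
        Relation.ReflTransGen
          (fun a b : Pt d => (∀ μ, a μ - 1 ≤ b μ ∧ b μ ≤ a μ + 1) ∧ a ∈ S.image m ∧ b ∈ S.image m) (m w₀) (m s) := by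
      intro s h
      induction h with
      | refl => exact Relation.ReflTransGen.refl
      | tail _ hbc ih =>
        obtain ⟨hdist, hbS, hcS⟩ := hbc
        refine ih.tail ⟨?_, Finset.mem_image_of_mem m hbS, Finset.mem_image_of_mem m hcS⟩
        intro μ
        exact ceil_king_of_dist hρ4 (by linarith) μ
    intro a ha
    obtain ⟨s, hs, rfl⟩ := Finset.mem_image.1 ha
    exact hlift s (net_chain hT hST hcov hw₀S hs)
  · intro x hx
    obtain ⟨w, hwT, hwx⟩ := hx
    obtain ⟨s, hs, hws⟩ := hcov w hwT
    exact ⟨m s, Finset.mem_image_of_mem m hs, fun μ => mem_block_of_near hρ4 hwx hws μ⟩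

end Summit.QuantumFields.BalabanUV.T4Continuum.NE9TreeBlockChain

end
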